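import Literature.NumberTheory.LFunctions.BondarenkoHeap2026OffDiagonalProofs
import Mathlib.Analysis.Fourier.FourierTransformDeriv
import HarnessLib

/-!
# Bondarenko–Heap 2026, §6.2 (towards `offDiag_reduction`): `Ŵ_T` is smooth with `∂^j Ŵ_T ≪_j T^{j+1}`

LABEL (C5 / rh-crit-ah, LADDER-RH §4 HELD «conditional bridges: exceptional zero ⇒ …»):
**NOT RH-BEARING.** RH-free real analysis of the weight `W_T` of arXiv:2608.07399v1, §2.1 (1);
nothing here bears on the truth of RH.

Layer L2d of the §6.2 reduction (see `ah/MEMO-t3-offDiagReduction.md`): the separation of variables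
"integration by parts shows `𝓕̃₀(s₁,s₂,s₃) ≪ Π(1+|t_i|)^{−j}`" (TeX l.826–828) differentiates the
factor `(1/T) Ŵ_T(log(1 + Rz/(KMxy))/2π)` arbitrarily often, which needs `Ŵ_T ∈ C^∞` with
`‖Ŵ_T^{(n)}‖_∞ ≤ C_n T^{n+1}`. PROVED here (theorems only):

* `integrable_abs_pow_mul_weight_one` — all moments `∫ |t|^n W_1(t) dt` are finite (`Φ` is Schwartz:
  the sibling's `WeightCalculus.integrable_moment`);
* `integrable_pow_smul_weight` — `t^n W_T(t)` is integrable (`W_T(t) ≤ W_1(t/T)` for `T ≥ 1`);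
* `contDiff_fourier_weight`, `contDiff_weightHat` — `Ŵ_T ∈ C^∞` (Mathlib `Real.contDiff_fourier`);
* `norm_iteratedDeriv_fourier_weight_le`, `abs_iteratedDeriv_weightHat_le` —
  `|Ŵ_T^{(n)}(ξ)| ≤ (2π)^n T^{n+1} ∫ |u|^n W_1(u) du` (Mathlib `Real.iteratedDeriv_fourier`:
  `Ŵ_T^{(n)} = 𝓕((−2πit)^n W_T)`, then `W_T(t) ≤ W_1(t/T)` and `t = Tu`);
* `exists_iteratedDeriv_weightHat_le` — the packaged `∀ n ∃ C_n ∀ T ≥ 1 ∀ ξ, |Ŵ_T^{(n)}(ξ)| ≤ C_n T^{n+1}`.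

Layer L2a (the first display of §6.2, TeX l.742–747): `jTerm_eq_zero_of_lt` — the `k`-sum of `J` is
finitely supported, `jTerm(k,m,n) = 0` for `k > L e^{4πσ/T}` (by (2)); `offDiagOD_eq_finite_sum` —
`𝒪𝒟 = J − 𝒟 = ∑_{m,n ≤ N} ∑_{k ≤ K₀, km ≠ n} jTerm(k,m,n)` as a finite triple sum (`𝒟` is the slice
`k = n/m`); `jTerm_shift_eq_zero` — the support restriction "`R ≪ KM/T`" (l.766): `jTerm(k,m,km+r) = 0`
once `8πσ·km < rT`; `sum_ne_eq_sum_shift_add_sum_shift` — "put `n = km + r`, `r ∈ ℤ ∖ {0}`": the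
inner sum over `n ≠ km` split into the shifts `r > 0` and `r < 0` (finite-sum bookkeeping);
`jTerm_eq_zero_of_neg_shift` — the same support restriction for `n = km − r`; and the assembled
**`offDiagOD_eq_sum_shifts`**: for `T > 4πσ/log 2`,
`𝒪𝒟 = Σ_{m ≤ N} Σ_{1 ≤ k ≤ K₀} (Σ_{1 ≤ r ≤ R(k,m), km+r ≤ N} jTerm(k,m,km+r) + Σ_{1 ≤ r ≤ min(km−1,R(k,m)), km−r ≤ N} jTerm(k,m,km−r))`,
`R(k,m) = ⌊8πσ km/T⌋` — i.e. the off-diagonal with BOTH support restrictions of l.766 built in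
(`k ≤ K₀ ≍ L`, `|r| ≤ 8πσ km/T`), ready for the dyadic partition in `k, m, r` (L2b) and the separation
of variables (L1, L2c).

Layer L2c (TeX l.785–795, "expand the polynomial `G₀` … by the multinomial theorem"):
`eval_add_add_eq_sum` (`P(A+B+C)` as a triple finite sum), `log_mul_add_eq`
(`log(km+r) = log k + log m + log(1+r/km)`), `G_mul_add_eq_sum` (`G(km+r)` as `f₀((km+r)/L)` times
the separated monomials in `log k/log L`, `log m/log L`, `log(1+r/km)/log L`).

## References

* [BondarenkoHeap2026] arXiv:2608.07399v1, §2.1 (1)–(2) p. 5; §6.2, TeX l.742–747, l.766–770, l.785–795, l.826–832.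
-/

noncomputable section

open Real Complex MeasureTheory
open scoped ContDiff FourierTransform

namespace Literature.NumberTheory.LFunctions.BondarenkoHeap2026

section WeightHatSmooth

/-- `W_T(t) ≤ W_1(t/T)` for `T ≥ 1` (copy of the private lemma of `…OffDiagonalProofs`).
[cite: BondarenkoHeap2026, §2.1 (1) p. 5] -/
private theorem weight_le_weight_one' (w : Bump) (B : ℕ) {T : ℝ} (hT : 1 ≤ T) (t : ℝ) :
    weight w B T t ≤ weight w B 1 (t / T) := by
  unfold weight
  have hT0 : 0 < T := by linarith
  have hg : 0 ≤ Phi w (t / T - 1) ^ 2 + Phi w (t / T + 1) ^ 2 := by positivity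
  simp only [one_pow, div_one]
  refine mul_le_mul_of_nonneg_right ?_ hg
  refine pow_le_pow_left₀ (by positivity) ?_ B
  rw [div_le_iff₀ (by positivity)]
  have h1 : (t / T) ^ 2 * T ^ 2 = t ^ 2 := by field_simp
  have h2 : (1 : ℝ) ≤ T ^ 2 := by nlinarith
  nlinarith

/-- **All moments of `W_1` are finite**: `|t|^n W_1(t)` is integrable. [cite: BondarenkoHeap2026, §2.1 (1) p. 5] -/
theorem integrable_abs_pow_mul_weight_one (w : Bump) (B n : ℕ) :
    Integrable fun t : ℝ => |t| ^ n * weight w B 1 t := by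
  set g : ℝ → ℝ := fun x => Phi w (x - 1) ^ 2 + Phi w (x + 1) ^ 2 with hg
  have hg0 : ∀ x, 0 ≤ g x := fun x => by simp only [hg]; positivity
  have hexp : (fun t : ℝ => |t| ^ n * weight w B 1 t) =
      fun t => ∑ j ∈ Finset.range (B + 1),
        (B.choose j : ℝ) * (1 / 4 : ℝ) ^ (B - j) * ‖t ^ (n + 2 * j) * g t‖ := by
    funext t
    have hw : weight w B 1 t = (t ^ 2 + 1 / 4) ^ B * g t := by
      simp only [weight, hg, one_pow, div_one]
    rw [hw, add_pow, Finset.sum_mul, Finset.mul_sum]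
    refine Finset.sum_congr rfl fun j _ => ?_
    rw [Real.norm_eq_abs, abs_mul, abs_of_nonneg (hg0 t), abs_pow, pow_add, pow_mul, sq_abs,
      ← pow_mul]
    ring
  rw [hexp]
  exact integrable_finsetSum _ fun j _ =>
    ((WeightCalculus.integrable_moment w (n + 2 * j)).norm).const_mul _

/-- `t^n W_T(t)` is integrable for `T ≥ 1` (domination by `|t|^n W_1(t/T)`), in the vector form used
by `Real.iteratedDeriv_fourier`. [cite: BondarenkoHeap2026, §2.1 (1) p. 5] -/
theorem integrable_pow_smul_weight (w : Bump) (B : ℕ) {T : ℝ} (hT : 1 ≤ T) (n : ℕ) :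
    Integrable fun t : ℝ => t ^ n • ((weight w B T t : ℝ) : ℂ) := by
  have hT0 : 0 < T := by linarith
  have hdom : Integrable fun t : ℝ => (fun u : ℝ => T ^ n * (|u| ^ n * weight w B 1 u)) (t / T) :=
    ((integrable_abs_pow_mul_weight_one w B n).const_mul (T ^ n)).comp_div hT0.ne'
  refine hdom.mono' ?_ (Filter.Eventually.of_forall fun t => ?_)
  · exact ((continuous_pow n).smul
      (continuous_ofReal.comp (continuous_weight w B T))).aestronglyMeasurable
  · simp only
    rw [norm_smul, norm_pow, Real.norm_eq_abs, Complex.norm_real,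
      Real.norm_eq_abs, abs_of_nonneg (weight_nonneg w B T t), abs_div, abs_of_pos hT0, div_pow,
      ← mul_assoc, mul_div_cancel₀ _ (pow_ne_zero n hT0.ne')]
    exact mul_le_mul_of_nonneg_left (weight_le_weight_one' w B hT t) (by positivity)

/-- The scalar form: `|t|^n W_T(t)` is integrable for `T ≥ 1`. [cite: BondarenkoHeap2026, §2.1 (1) p. 5] -/
theorem integrable_abs_pow_mul_weight (w : Bump) (B : ℕ) {T : ℝ} (hT : 1 ≤ T) (n : ℕ) :
    Integrable fun t : ℝ => |t| ^ n * weight w B T t := by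
  have h := (integrable_pow_smul_weight w B hT n).norm
  refine h.congr (Filter.Eventually.of_forall fun t => ?_)
  simp only
  rw [norm_smul, norm_pow, Real.norm_eq_abs, Complex.norm_real, Real.norm_eq_abs,
    abs_of_nonneg (weight_nonneg w B T t)]

/-- **`𝓕W_T ∈ C^∞`.** [cite: BondarenkoHeap2026, §6.2, TeX l.826–828] -/
theorem contDiff_fourier_weight (w : Bump) (B : ℕ) {T : ℝ} (hT : 1 ≤ T) :
    ContDiff ℝ ∞ (𝓕 fun t : ℝ => ((weight w B T t : ℝ) : ℂ)) := by
  refine Real.contDiff_fourier (N := (⊤ : ℕ∞)) fun n _ => ?_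
  refine (integrable_abs_pow_mul_weight w B hT n).congr (Filter.Eventually.of_forall fun t => ?_)
  simp only [Real.norm_eq_abs, Complex.norm_real, abs_of_nonneg (weight_nonneg w B T t)]

/-- **`Ŵ_T ∈ C^∞`** (real part of `𝓕W_T`). [cite: BondarenkoHeap2026, §6.2, TeX l.826–828] -/
theorem contDiff_weightHat (w : Bump) (B : ℕ) {T : ℝ} (hT : 1 ≤ T) :
    ContDiff ℝ ∞ (weightHat w B T) := by
  have h : weightHat w B T = (fun z : ℂ => z.re) ∘ 𝓕 fun t : ℝ => ((weight w B T t : ℝ) : ℂ) := by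
    funext ξ; rfl
  rw [h]
  exact Complex.reCLM.contDiff.comp (contDiff_fourier_weight w B hT)

/-- **`|𝓕W_T^{(n)}(ξ)| ≤ (2π)^n T^{n+1} ∫ |u|^n W_1(u) du`** (`T ≥ 1`): the `n`-th derivative is
`𝓕((−2πit)^n W_T)`, bounded by `∫ (2π|t|)^n W_T(t) dt ≤ (2π)^n ∫ |t|^n W_1(t/T) dt`.
[cite: BondarenkoHeap2026, §6.2, TeX l.826–828] -/
theorem norm_iteratedDeriv_fourier_weight_le (w : Bump) (B : ℕ) {T : ℝ} (hT : 1 ≤ T) (n : ℕ)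
    (ξ : ℝ) :
    ‖iteratedDeriv n (𝓕 fun t : ℝ => ((weight w B T t : ℝ) : ℂ)) ξ‖ ≤
      (2 * π) ^ n * T ^ (n + 1) * ∫ u : ℝ, |u| ^ n * weight w B 1 u := by
  have hT0 : 0 < T := by linarith
  rw [Real.iteratedDeriv_fourier (N := (⊤ : ℕ∞)) (fun k _ => integrable_pow_smul_weight w B hT k)
    (by exact_mod_cast le_top)]
  rw [Real.fourier_real_eq_integral_exp_smul]
  refine (norm_integral_le_integral_norm _).trans ?_
  -- pointwise: `‖e(−vξ) • ((−2πiv)^n • W_T(v))‖ = (2π|v|)^n W_T(v) ≤ (2π)^n |v|^n W_1(v/T)`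
  have hptw : ∀ v : ℝ, ‖Complex.exp (((-2 * π * v * ξ : ℝ) : ℂ) * Complex.I) •
      ((-2 * (π : ℂ) * Complex.I * v) ^ n • ((weight w B T v : ℝ) : ℂ))‖ ≤
      (fun x : ℝ => (2 * π) ^ n * (|x| ^ n * weight w B 1 x)) (v / T) * T ^ n := by
    intro v
    rw [norm_smul, Complex.norm_exp_ofReal_mul_I, one_mul, norm_smul, norm_pow, Complex.norm_real,
      Real.norm_eq_abs, abs_of_nonneg (weight_nonneg w B T v)]
    have hn : ‖-2 * (π : ℂ) * Complex.I * v‖ = 2 * π * |v| := by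
      rw [norm_mul, norm_mul, norm_mul, norm_neg, Complex.norm_I, Complex.norm_real,
        Real.norm_eq_abs, Complex.norm_ofNat, Complex.norm_real, Real.norm_eq_abs,
        abs_of_pos Real.pi_pos]
      ring
    rw [hn]
    simp only
    rw [abs_div, abs_of_pos hT0, div_pow, mul_pow]
    have hw := weight_le_weight_one' w B hT v
    have h1 : (2 * π) ^ n * |v| ^ n * weight w B T v ≤ (2 * π) ^ n * |v| ^ n * weight w B 1 (v / T) :=
      mul_le_mul_of_nonneg_left hw (by positivity)
    calc (2 * π) ^ n * |v| ^ n * weight w B T v ≤ (2 * π) ^ n * |v| ^ n * weight w B 1 (v / T) := h1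
      _ = (2 * π) ^ n * (|v| ^ n / T ^ n * weight w B 1 (v / T)) * T ^ n := by
          field_simp
  have hdom : Integrable fun v : ℝ =>
      (fun x : ℝ => (2 * π) ^ n * (|x| ^ n * weight w B 1 x)) (v / T) * T ^ n :=
    (((integrable_abs_pow_mul_weight_one w B n).const_mul _).comp_div hT0.ne').mul_const _
  refine (integral_mono_of_nonneg (Filter.Eventually.of_forall fun v => norm_nonneg _) hdom
    (Filter.Eventually.of_forall hptw)).trans (le_of_eq ?_)
  rw [integral_mul_const, Measure.integral_comp_div (fun x : ℝ => (2 * π) ^ n * (|x| ^ n * weight w B 1 x)) T,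
    abs_of_pos hT0, smul_eq_mul, integral_const_mul]
  ring

/-- The `n`-th derivative of `Ŵ_T = Re 𝓕W_T` is the real part of that of `𝓕W_T`.
[cite: BondarenkoHeap2026, §2.1 (2)–(3) p. 5] -/
theorem iteratedDeriv_weightHat_eq_re (w : Bump) (B : ℕ) {T : ℝ} (hT : 1 ≤ T) (n : ℕ) (ξ : ℝ) :
    iteratedDeriv n (weightHat w B T) ξ =
      (iteratedDeriv n (𝓕 fun t : ℝ => ((weight w B T t : ℝ) : ℂ)) ξ).re := by
  have h : weightHat w B T = (⇑Complex.reCLM) ∘ 𝓕 fun t : ℝ => ((weight w B T t : ℝ) : ℂ) := by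
    funext ξ; rfl
  rw [h, iteratedDeriv_eq_iteratedFDeriv, iteratedDeriv_eq_iteratedFDeriv,
    ContinuousLinearMap.iteratedFDeriv_comp_left Complex.reCLM
      ((contDiff_fourier_weight w B hT).contDiffAt) (by exact_mod_cast le_top)]
  rfl

/-- **`|Ŵ_T^{(n)}(ξ)| ≤ (2π)^n T^{n+1} ∫ |u|^n W_1(u) du`** for `T ≥ 1`. [cite: BondarenkoHeap2026, §6.2, TeX l.826–828] -/
theorem abs_iteratedDeriv_weightHat_le (w : Bump) (B : ℕ) {T : ℝ} (hT : 1 ≤ T) (n : ℕ) (ξ : ℝ) :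
    |iteratedDeriv n (weightHat w B T) ξ| ≤
      (2 * π) ^ n * T ^ (n + 1) * ∫ u : ℝ, |u| ^ n * weight w B 1 u := by
  rw [iteratedDeriv_weightHat_eq_re w B hT]
  exact (Complex.abs_re_le_norm _).trans (norm_iteratedDeriv_fourier_weight_le w B hT n ξ)

/-- **Packaged: `Ŵ_T ∈ C^∞` with `‖Ŵ_T^{(n)}‖_∞ ≤ C_n T^{n+1}`** (`C_n = (2π)^n ∫|u|^n W_1` depends on
the datum `(w, B)` and `n` only). [cite: BondarenkoHeap2026, §6.2, TeX l.826–828] -/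
theorem exists_iteratedDeriv_weightHat_le (w : Bump) (B n : ℕ) :
    ∃ C : ℝ, 0 ≤ C ∧ ∀ T : ℝ, 1 ≤ T → ContDiff ℝ ∞ (weightHat w B T) ∧
      ∀ ξ : ℝ, |iteratedDeriv n (weightHat w B T) ξ| ≤ C * T ^ (n + 1) := by
  refine ⟨(2 * π) ^ n * ∫ u : ℝ, |u| ^ n * weight w B 1 u, ?_, fun T hT => ⟨contDiff_weightHat w B hT,
    fun ξ => ?_⟩⟩
  · exact mul_nonneg (by positivity)
      (integral_nonneg fun u => mul_nonneg (by positivity) (weight_nonneg w B 1 u))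
  · calc |iteratedDeriv n (weightHat w B T) ξ|
        ≤ (2 * π) ^ n * T ^ (n + 1) * ∫ u : ℝ, |u| ^ n * weight w B 1 u :=
          abs_iteratedDeriv_weightHat_le w B hT n ξ
      _ = (2 * π) ^ n * (∫ u : ℝ, |u| ^ n * weight w B 1 u) * T ^ (n + 1) := by ring

end WeightHatSmooth

section OffDiagReindex

open Finset

/-- **Finite support of the `k`-sum** (by (2)): for `T > 4πσ·0`… precisely, for `T > 0`,
`1 ≤ m`, `1 ≤ n ≤ L` and `k > L·e^{4πσ/T}`, the summand `jTerm k m n` of `J` vanishes, since then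
`log(km/n) > 4πσ/T`, i.e. `|log(km/n)/2π| > 2σ/T`. [cite: BondarenkoHeap2026, §2.2 p. 7 ("the `k`-sum is finite by (2)"), §6.2 l.766 (`KM ≪ L`)] -/
theorem jTerm_eq_zero_of_lt (c : ℝ) (w : Bump) (B : ℕ) (r : ℕ → ℝ) {L T : ℝ} (hT : 0 < T)
    {k m n : ℕ} (hm : 1 ≤ m) (hn1 : 1 ≤ n) (hnL : (n : ℝ) ≤ L)
    (hk : L * Real.exp (4 * π * w.σ / T) < k) :
    jTerm c w B r T k m n = 0 := by
  have hσ : 0 < w.σ := w.σ_pos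
  have hm0 : (0 : ℝ) < m := by exact_mod_cast hm
  have hn0 : (0 : ℝ) < n := by exact_mod_cast hn1
  have hE0 : 0 < Real.exp (4 * π * w.σ / T) := Real.exp_pos _
  have hL0 : 0 < L := lt_of_lt_of_le (by exact_mod_cast hn1) hnL
  have hk0 : (0 : ℝ) < k := lt_of_le_of_lt (by positivity) hk
  have hq : Real.exp (4 * π * w.σ / T) < (k : ℝ) * m / n := by
    rw [lt_div_iff₀ hn0]
    have h1 : L * Real.exp (4 * π * w.σ / T) * 1 ≤ (k : ℝ) * m := by
      have hm1 : (1 : ℝ) ≤ m := by exact_mod_cast hm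
      exact mul_le_mul hk.le hm1 zero_le_one hk0.le
    have hkm : (k : ℝ) ≤ k * m := le_mul_of_one_le_right hk0.le (by exact_mod_cast hm)
    have hcomm : Real.exp (4 * π * w.σ / T) * L = L * Real.exp (4 * π * w.σ / T) := mul_comm _ _
    calc Real.exp (4 * π * w.σ / T) * n ≤ Real.exp (4 * π * w.σ / T) * L :=
          mul_le_mul_of_nonneg_left hnL hE0.le
      _ < (k : ℝ) * m := by linarith
  have hlog : 4 * π * w.σ / T < Real.log ((k : ℝ) * m / n) := by
    have := Real.log_lt_log hE0 hq
    rwa [Real.log_exp] at this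
  have hpos : 0 < Real.log ((k : ℝ) * m / n) := lt_trans (by positivity) hlog
  unfold jTerm
  rw [weightHat_eq_zero_of_lt w B hT, mul_zero]
  rw [abs_of_pos (by positivity), lt_div_iff₀ Real.two_pi_pos]
  calc 2 * w.σ / T * (2 * π) = 4 * π * w.σ / T := by ring
    _ < Real.log ((k : ℝ) * m / n) := hlog

/-- **`𝒪𝒟` as a finite triple sum over `km ≠ n`**: with `N = ⌊L⌋`, `K₀ = ⌈L e^{4πσ/T}⌉`,
`𝒪𝒟 = ∑_{m,n ≤ N} ∑_{k ≤ K₀, km ≠ n} jTerm(k,m,n)` ("The exact off-diagonals are given by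
`𝒪𝒟 = Σ_{m,n ≤ L, r ≠ 0, k ≪ L : n − km = r} …`", §6.2 first display).
[cite: BondarenkoHeap2026, §6.2, TeX l.742–747] -/
theorem offDiagOD_eq_finite_sum (c : ℝ) (w : Bump) (B : ℕ) (ρ : Resonator) {q : ℕ} (hq : 1 ≤ q)
    (χ : DirichletCharacter ℂ q) :
    offDiagOD c w B ρ χ = ∑ m ∈ Icc 1 ⌊lengthL q⌋₊, ∑ n ∈ Icc 1 ⌊lengthL q⌋₊,
      ∑ k ∈ Finset.range (⌈lengthL q * Real.exp (4 * π * w.σ / ρ.T q)⌉₊ + 1),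
        (if k * m = n then 0 else jTerm c w B (ρ.coeff χ) (ρ.T q) k m n) := by
  classical
  set L := lengthL q with hL
  set T := ρ.T q with hT
  set N := ⌊L⌋₊ with hN
  set K₀ := ⌈L * Real.exp (4 * π * w.σ / T)⌉₊ with hK₀
  have hq1 : (1 : ℝ) ≤ q := by exact_mod_cast hq
  have hT0 : 0 < T := lt_of_lt_of_le (by linarith) (le_T ρ hq)
  have hL0 : 0 < L := by rw [hL, lengthL]; positivity
  have hNL : (N : ℝ) ≤ L := Nat.floor_le hL0.le
  -- vanishing beyond `K₀`
  have hzero : ∀ m ∈ Icc 1 N, ∀ n ∈ Icc 1 N, ∀ k : ℕ, k ∉ Finset.range (K₀ + 1) →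
      jTerm c w B (ρ.coeff χ) T k m n = 0 := by
    intro m hm n hn k hk
    have hm1 := (mem_Icc.mp hm).1
    obtain ⟨hn1, hnN⟩ := mem_Icc.mp hn
    have hkK : K₀ + 1 ≤ k := by simpa [Finset.mem_range, not_lt] using hk
    refine jTerm_eq_zero_of_lt c w B (ρ.coeff χ) hT0 hm1 hn1 (le_trans (by exact_mod_cast hnN) hNL) ?_
    have h1 : L * Real.exp (4 * π * w.σ / T) ≤ K₀ := Nat.le_ceil _
    have h2 : ((K₀ + 1 : ℕ) : ℝ) ≤ k := by exact_mod_cast hkK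
    push_cast at h2
    linarith
  -- `J` as a finite sum
  have hJ : J c w B ρ χ = ∑ m ∈ Icc 1 N, ∑ n ∈ Icc 1 N, ∑ k ∈ Finset.range (K₀ + 1),
      jTerm c w B (ρ.coeff χ) T k m n := by
    rw [J_eq_sum_jTerm]
    refine sum_congr rfl fun m hm => sum_congr rfl fun n hn => ?_
    exact tsum_eq_sum fun k hk => hzero m hm n hn k hk
  -- `𝒟` as the `k = n/m` slice of the same finite sum
  have hD : diagD c w B ρ χ = ∑ m ∈ Icc 1 N, ∑ n ∈ Icc 1 N, ∑ k ∈ Finset.range (K₀ + 1),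
      (if k * m = n then jTerm c w B (ρ.coeff χ) T k m n else 0) := by
    rw [diagD, ← hT, ← hL, ← hN]
    refine sum_congr rfl fun m hm => sum_congr rfl fun n hn => ?_
    have hm1 := (mem_Icc.mp hm).1
    obtain ⟨hn1, hnN⟩ := mem_Icc.mp hn
    by_cases hmn : m ∣ n
    · rw [if_pos hmn]
      obtain ⟨d, rfl⟩ := hmn
      have hd : m * d / m = d := Nat.mul_div_cancel_left d (by omega)
      rw [hd]
      -- the only `k` with `k * m = m * d` is `k = d`
      have hsum : ∑ k ∈ Finset.range (K₀ + 1),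
          (if k * m = m * d then jTerm c w B (ρ.coeff χ) T k m (m * d) else 0) =
          ∑ k ∈ Finset.range (K₀ + 1), (if k = d then jTerm c w B (ρ.coeff χ) T k m (m * d) else 0) := by
        refine sum_congr rfl fun k _ => ?_
        have : (k * m = m * d) ↔ (k = d) := by
          constructor
          · intro h; rw [mul_comm] at h; exact Nat.eq_of_mul_eq_mul_left (by omega) h
          · rintro rfl; ring
        simp only [this]
      rw [hsum, sum_ite_eq']
      split_ifs with hdK
      · rfl
      · exact hzero m hm (m * d) hn d hdK
    · rw [if_neg hmn]
      symm
      refine sum_eq_zero fun k _ => ?_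
      rw [if_neg]
      rintro rfl
      exact hmn ⟨k, by ring⟩
  rw [offDiagOD, hJ, hD, ← sum_sub_distrib]
  refine sum_congr rfl fun m _ => ?_
  rw [← sum_sub_distrib]
  refine sum_congr rfl fun n _ => ?_
  rw [← sum_sub_distrib]
  refine sum_congr rfl fun k _ => ?_
  split_ifs <;> ring

end OffDiagReindex

section G0Expansion

open Finset

/-- **Trinomial expansion of a polynomial value**: `P(A + B + C) = Σ_{i ≤ deg P} Σ_{j ≤ i} Σ_{a ≤ j}
p_i C(i,j) C(j,a) A^a B^{j−a} C^{i−j}` ("we expand the polynomial `G₀`, write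
`log(km+r) = log k + log m + log(1 + r/km)` in each monomial, and then expand the powers of this by
the multinomial theorem", TeX l.785–790). [cite: BondarenkoHeap2026, §6.2, TeX l.785–790] -/
theorem eval_add_add_eq_sum (P : Polynomial ℝ) (A B C : ℝ) :
    P.eval (A + B + C) = ∑ i ∈ range (P.natDegree + 1), ∑ j ∈ range (i + 1), ∑ a ∈ range (j + 1),
      P.coeff i * (i.choose j : ℝ) * (j.choose a : ℝ) * A ^ a * B ^ (j - a) * C ^ (i - j) := by
  rw [Polynomial.eval_eq_sum_range]
  refine sum_congr rfl fun i _ => ?_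
  rw [add_pow, mul_sum]
  refine sum_congr rfl fun j _ => ?_
  rw [add_pow, sum_mul, sum_mul, mul_sum]
  refine sum_congr rfl fun a _ => ?_
  ring

/-- `log(km + r) = log k + log m + log(1 + r/(km))` for `k, m ≥ 1`, `r ≥ 0`. [cite: BondarenkoHeap2026, §6.2, TeX l.787] -/
theorem log_mul_add_eq {k m : ℕ} (hk : 1 ≤ k) (hm : 1 ≤ m) (r : ℕ) :
    Real.log ((k * m + r : ℕ) : ℝ) =
      Real.log k + Real.log m + Real.log (1 + (r : ℝ) / ((k : ℝ) * m)) := by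
  have hk0 : (0 : ℝ) < k := by exact_mod_cast hk
  have hm0 : (0 : ℝ) < m := by exact_mod_cast hm
  have hkm : (0 : ℝ) < (k : ℝ) * m := mul_pos hk0 hm0
  have h : ((k * m + r : ℕ) : ℝ) = ((k : ℝ) * m) * (1 + (r : ℝ) / ((k : ℝ) * m)) := by
    push_cast; field_simp
  rw [h, Real.log_mul hkm.ne' (by positivity), Real.log_mul hk0.ne' hm0.ne']

/-- **The resonator weight at `km + r`, separated** (the `O_G(1)` monomials of TeX l.785–795):
`G(km+r) = f₀((km+r)/L) · Σ_{i,j,a} g_i C(i,j) C(j,a) (log k/log L)^a (log m/log L)^{j−a}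
(log(1+r/km)/log L)^{i−j}` (`G₀ = Σ g_i X^i`). [cite: BondarenkoHeap2026, §6.2, TeX l.785–795] -/
theorem G_mul_add_eq_sum (ρ : Resonator) (q : ℕ) {k m : ℕ} (hk : 1 ≤ k) (hm : 1 ≤ m) (r : ℕ) :
    ρ.G q (k * m + r) = ρ.f₀ (((k * m + r : ℕ) : ℝ) / lengthL q) *
      ∑ i ∈ range (ρ.G₀.natDegree + 1), ∑ j ∈ range (i + 1), ∑ a ∈ range (j + 1),
        ρ.G₀.coeff i * (i.choose j : ℝ) * (j.choose a : ℝ) *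
          (Real.log k / Real.log (lengthL q)) ^ a * (Real.log m / Real.log (lengthL q)) ^ (j - a) *
            (Real.log (1 + (r : ℝ) / ((k : ℝ) * m)) / Real.log (lengthL q)) ^ (i - j) := by
  rw [Resonator.G, log_mul_add_eq hk hm r, add_div, add_div, eval_add_add_eq_sum, mul_comm]

end G0Expansion

section SupportRestriction

/-- **Support restriction `R ≪ KM/T`** ("from the support of `Ŵ` we have the restrictions
`R ≪ KM/T`", TeX l.766): for `T > 4πσ/log 2`, `km ≥ 1` and `8πσ·km < rT`, the off-diagonal term
`jTerm(k, m, km + r)` vanishes (`Ŵ_T` is even and vanishes for `|ξ| > 2σ/T`).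
[cite: BondarenkoHeap2026, §6.2, TeX l.766–770] -/
theorem jTerm_shift_eq_zero (c : ℝ) (w : Bump) (B : ℕ) (r' : ℕ → ℝ) {T : ℝ}
    (hT : 4 * π * w.σ / Real.log 2 < T) {k m r : ℕ} (hkm : 1 ≤ k * m)
    (h : 8 * π * w.σ * ((k * m : ℕ) : ℝ) < r * T) :
    jTerm c w B r' T k m (k * m + r) = 0 := by
  have hσ : 0 < w.σ := w.σ_pos
  have hT0 : 0 < T := lt_trans (by positivity) hT
  have hkm0 : (0 : ℝ) < ((k * m : ℕ) : ℝ) := by exact_mod_cast hkm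
  have hn0 : (0 : ℝ) < ((k * m + r : ℕ) : ℝ) := by positivity
  unfold jTerm
  have hlog : Real.log ((k : ℝ) * m / ((k * m + r : ℕ) : ℝ)) =
      -Real.log (((k * m + r : ℕ) : ℝ) / ((k * m : ℕ) : ℝ)) := by
    rw [← Real.log_inv, inv_div]; push_cast; ring_nf
  rw [hlog, neg_div, weightHat_even]
  rw [weightHat_shift_eq_zero hσ (fun ξ hξ => weightHat_eq_zero_of_lt w B hT0 hξ) hT hkm h,
    mul_zero]

end SupportRestriction

section ShiftSplit

open Finset

/-- **"Put `n = km + r`, `r ∈ ℤ ∖ {0}`" as finite-sum bookkeeping**: for `P ≥ 1` (read `P = km`) and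
any `F`, `Σ_{1 ≤ n ≤ N, n ≠ P} F(n) = Σ_{1 ≤ r ≤ N, P + r ≤ N} F(P + r) + Σ_{1 ≤ r ≤ P − 1, P − r ≤ N} F(P − r)`
(the cases `r > 0` and "`r < 0` similar", TeX l.749). [cite: BondarenkoHeap2026, §6.2, TeX l.742–749] -/
theorem sum_ne_eq_sum_shift_add_sum_shift (N : ℕ) {P : ℕ} (hP : 1 ≤ P) (F : ℕ → ℝ) :
    ∑ n ∈ Icc 1 N, (if P = n then 0 else F n) =
      ∑ r ∈ Icc 1 N, (if P + r ≤ N then F (P + r) else 0) +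
        ∑ r ∈ Icc 1 (P - 1), (if P - r ≤ N then F (P - r) else 0) := by
  -- split `n ≠ P` into `n > P` and `n < P`
  have hsplit : ∀ n ∈ Icc 1 N, (if P = n then 0 else F n) =
      (if P < n then F n else 0) + (if n < P then F n else 0) := by
    intro n _
    rcases lt_trichotomy P n with h | h | h
    · rw [if_neg h.ne, if_pos h, if_neg (not_lt.mpr h.le), add_zero]
    · subst h; simp
    · rw [if_neg h.ne', if_neg (not_lt.mpr h.le), if_pos h, zero_add]
  rw [sum_congr rfl hsplit, sum_add_distrib]
  congr 1
  · -- `n > P`: `n = P + r`, `1 ≤ r`, `P + r ≤ N`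
    rw [← sum_filter, ← sum_filter]
    refine sum_nbij' (fun n => n - P) (fun r => P + r) ?_ ?_ ?_ ?_ ?_
    · intro n hn; simp only [mem_filter, mem_Icc] at hn ⊢; omega
    · intro r hr; simp only [mem_filter, mem_Icc] at hr ⊢; omega
    · intro n hn; simp only [mem_filter, mem_Icc] at hn; omega
    · intro r _; omega
    · intro n hn; simp only [mem_filter, mem_Icc] at hn; congr 1; omega
  · -- `n < P`: `n = P - r`, `1 ≤ r ≤ P - 1`, `P - r ≤ N`
    rw [← sum_filter, ← sum_filter]
    refine sum_nbij' (fun n => P - n) (fun r => P - r) ?_ ?_ ?_ ?_ ?_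
    · intro n hn; simp only [mem_filter, mem_Icc] at hn ⊢; omega
    · intro r hr; simp only [mem_filter, mem_Icc] at hr ⊢; omega
    · intro n hn; simp only [mem_filter, mem_Icc] at hn; omega
    · intro r hr; simp only [mem_filter, mem_Icc] at hr; omega
    · intro n hn; simp only [mem_filter, mem_Icc] at hn; congr 1; omega

end ShiftSplit


section SupportRestrictionNeg

/-- **Support restriction for negative shifts**: for `T > 4πσ/log 2`, `n ≥ 1`, `km = n + r` and
`8πσ·n < rT`, `jTerm(k, m, n) = 0` (the case "`r < 0`", TeX l.749, of `R ≪ KM/T`).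
[cite: BondarenkoHeap2026, §6.2, TeX l.749, l.766–770] -/
theorem jTerm_eq_zero_of_neg_shift (c : ℝ) (w : Bump) (B : ℕ) (r' : ℕ → ℝ) {T : ℝ}
    (hT : 4 * π * w.σ / Real.log 2 < T) {k m n r : ℕ} (hn : 1 ≤ n) (hkm : k * m = n + r)
    (h : 8 * π * w.σ * n < r * T) :
    jTerm c w B r' T k m n = 0 := by
  have hσ : 0 < w.σ := w.σ_pos
  have hT0 : 0 < T := lt_trans (by positivity) hT
  unfold jTerm
  have hcast : (k : ℝ) * m = ((n + r : ℕ) : ℝ) := by exact_mod_cast hkm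
  rw [hcast, weightHat_shift_eq_zero hσ (fun ξ hξ => weightHat_eq_zero_of_lt w B hT0 hξ) hT hn h,
    mul_zero]

end SupportRestrictionNeg

section ShiftTruncation

open Finset

/-- `jTerm(0, m, n) = 0` (`Λ(0) = 0`). [cite: BondarenkoHeap2026, Theorem 4 p. 8 (J)] -/
private theorem jTerm_zero_left (c : ℝ) (w : Bump) (B : ℕ) (r' : ℕ → ℝ) (T : ℝ) (m n : ℕ) :
    jTerm c w B r' T 0 m n = 0 := by
  simp [jTerm]

/-- **`𝒪𝒟` over the shifts `0 < |r| ≤ 8πσ·km/T`** ("from the support of `Ŵ` we have the restrictions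
`R ≪ KM/T`", TeX l.766; both signs of `r`, l.749): for `T > 4πσ/log 2`, with `N = ⌊L⌋`,
`K₀ = ⌈L e^{4πσ/T}⌉` and `R(k,m) = ⌊8πσ km/T⌋`,
`𝒪𝒟 = Σ_{m ≤ N} Σ_{1 ≤ k ≤ K₀} (Σ_{1 ≤ r ≤ R(k,m), km+r ≤ N} jTerm(k,m,km+r) + Σ_{1 ≤ r ≤ min(km−1, R(k,m)), km−r ≤ N} jTerm(k,m,km−r))`.
[cite: BondarenkoHeap2026, §6.2, TeX l.742–770] -/
theorem offDiagOD_eq_sum_shifts (c : ℝ) (w : Bump) (B : ℕ) (ρ : Resonator) {q : ℕ} (hq : 1 ≤ q)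
    (hT : 4 * π * w.σ / Real.log 2 < ρ.T q) (χ : DirichletCharacter ℂ q) :
    offDiagOD c w B ρ χ = ∑ m ∈ Icc 1 ⌊lengthL q⌋₊,
      ∑ k ∈ Icc 1 ⌈lengthL q * Real.exp (4 * π * w.σ / ρ.T q)⌉₊,
        ((∑ r ∈ Icc 1 ⌊8 * π * w.σ * ((k * m : ℕ) : ℝ) / ρ.T q⌋₊,
            if k * m + r ≤ ⌊lengthL q⌋₊ then jTerm c w B (ρ.coeff χ) (ρ.T q) k m (k * m + r) else 0) +
          ∑ r ∈ Icc 1 (min (k * m - 1) ⌊8 * π * w.σ * ((k * m : ℕ) : ℝ) / ρ.T q⌋₊),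
            if k * m - r ≤ ⌊lengthL q⌋₊ then jTerm c w B (ρ.coeff χ) (ρ.T q) k m (k * m - r) else 0) := by
  classical
  set L := lengthL q with hL
  set T := ρ.T q with hTdef
  set N := ⌊L⌋₊ with hN
  set K₀ := ⌈L * Real.exp (4 * π * w.σ / T)⌉₊ with hK₀
  have hσ : 0 < w.σ := w.σ_pos
  have hT0 : 0 < T := lt_trans (by positivity) hT
  rw [offDiagOD_eq_finite_sum c w B ρ hq χ, ← hL, ← hTdef, ← hN, ← hK₀]
  refine sum_congr rfl fun m hm => ?_
  have hm1 : 1 ≤ m := (mem_Icc.mp hm).1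
  -- swap `n` and `k`, drop `k = 0`
  rw [sum_comm]
  have hrange : Finset.range (K₀ + 1) = insert 0 (Icc 1 K₀) := by
    ext k; simp only [Finset.mem_range, Finset.mem_insert, mem_Icc]; omega
  rw [hrange, sum_insert (by simp)]
  have h0 : ∑ n ∈ Icc 1 N, (if 0 * m = n then (0 : ℝ) else jTerm c w B (ρ.coeff χ) T 0 m n) = 0 :=
    sum_eq_zero fun n _ => by rw [jTerm_zero_left]; simp
  rw [h0, zero_add]
  refine sum_congr rfl fun k hk => ?_
  have hk1 : 1 ≤ k := (mem_Icc.mp hk).1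
  have hP : 1 ≤ k * m := Nat.one_le_iff_ne_zero.mpr (Nat.mul_ne_zero (by omega) (by omega))
  rw [sum_ne_eq_sum_shift_add_sum_shift N hP]
  set R : ℕ := ⌊8 * π * w.σ * ((k * m : ℕ) : ℝ) / T⌋₊ with hR
  -- shifts `r > R` vanish (both signs)
  have hbig : ∀ r : ℕ, R < r → 8 * π * w.σ * ((k * m : ℕ) : ℝ) < r * T := by
    intro r hr
    have h1 : 8 * π * w.σ * ((k * m : ℕ) : ℝ) / T < r := by
      have := Nat.lt_floor_add_one (8 * π * w.σ * ((k * m : ℕ) : ℝ) / T)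
      have h2 : ((R + 1 : ℕ) : ℝ) ≤ r := by exact_mod_cast hr
      push_cast at h2; rw [hR] at h2; linarith
    rwa [div_lt_iff₀ hT0] at h1
  congr 1
  · -- positive shifts: restrict `Icc 1 N` to `Icc 1 R` (terms with `r > R` vanish; terms with
    -- `r > N` are guarded by `k m + r ≤ N`)
    rw [← sum_filter_add_sum_filter_not (Icc 1 N) (fun r => r ≤ R),
      ← sum_filter_add_sum_filter_not (Icc 1 R) (fun r => r ≤ N)]
    have hA : (Icc 1 N).filter (fun r => r ≤ R) = (Icc 1 R).filter (fun r => r ≤ N) := by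
      ext r; simp only [mem_filter, mem_Icc]; omega
    rw [hA]
    congr 1
    rw [sum_eq_zero, sum_eq_zero]
    · intro r hr
      simp only [mem_filter, mem_Icc, not_le] at hr
      rw [if_neg (by omega)]
    · intro r hr
      simp only [mem_filter, mem_Icc, not_le] at hr
      split_ifs with hle
      · exact jTerm_shift_eq_zero c w B (ρ.coeff χ) hT hP (hbig r hr.2)
      · rfl
  · -- negative shifts
    rw [← sum_filter_add_sum_filter_not (Icc 1 (k * m - 1)) (fun r => r ≤ R)]
    have hA : (Icc 1 (k * m - 1)).filter (fun r => r ≤ R) = Icc 1 (min (k * m - 1) R) := by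
      ext r; simp only [mem_filter, mem_Icc, le_min_iff]; omega
    rw [hA, add_eq_left]
    refine sum_eq_zero fun r hr => ?_
    simp only [mem_filter, mem_Icc, not_le] at hr
    split_ifs with hle
    · refine jTerm_eq_zero_of_neg_shift c w B (ρ.coeff χ) hT (n := k * m - r) (r := r) (by omega)
        (by omega) ?_
      have h1 := hbig r hr.2
      have h2 : ((k * m - r : ℕ) : ℝ) ≤ ((k * m : ℕ) : ℝ) := by exact_mod_cast Nat.sub_le _ _
      have h3 := mul_le_mul_of_nonneg_left h2 (by positivity : (0 : ℝ) ≤ 8 * π * w.σ)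
      linarith
    · rfl

end ShiftTruncation

end Literature.NumberTheory.LFunctions.BondarenkoHeap2026
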